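import Summits.BirchSwinnertonDyer.BirchSwinnertonDyer.Theorems.ByReductionTypeAtTwoOrdKatoHalfAtTwoIsoMuFreeValueNegOfGreenbergMu
import Summits.BirchSwinnertonDyer.BirchSwinnertonDyer.Theorems.ByReductionTypeAtTwoOrdKatoHalfAtTwoIsoColemanMuPoitouTateGreenbergMu
import Summits.BirchSwinnertonDyer.BirchSwinnertonDyer.Theorems.OrdKatoHalfAtTwoIso.Negative.ZetaColemanMuTwoDivisible
import Literature.Uncategorized.OrdPublishedInputsAtTwo
import HarnessLib

/-!
# Vet49s1e — crux-triage r1 seat 1, GEN 49: KERNEL-EXACT BY-NAME VET of w3 GEN 7's landed lossless split (p736704 doors + p737300 §5, modules now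
# BUILT) against the REGISTERED v24 stub `stub_muFreeValue_negDisc_two` (skeleton 4921f2ec, ledger signature 1 229 ch, pasted verbatim below), and
# the ROUTE DECL `OrdKatoHalfAtTwoIso` from {G11⁺, G11⁻, PUB, AU, not-onto cell} with BOTH onto cells now discharged by LANDED theorems BY NAME.

(E1) `registered_iff_split`: the REGISTERED V♭⁻ text ⟺ (G11⁻ ∧ MU13⁻) is `exact muFreeValue_negDisc_iff_greenbergMuNeg_and_zetaQuotientMu` —
     the v24 stub and w3's option-(b) pair {`GreenbergMuZeroTwoOrdNegDisc`, `ZetaQuotientMuZeroTwoOrdNegDisc`} are INTERCHANGEABLE modulo the four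
     print/cite inputs BY NAME {p729889 Poitou–Tate exactness, p727215 ordinary-kernel functional, `thm12_4`, PUB}; (E2) the (⇐) direction a v25
     drop-in consumes needs only {p729889, PUB}.
(E3) `crux_of_g11_landed`: the crux from G11⁺ (p733065 def) and G11⁻ (p735706 def) + PUB + Abbes–Ullmo + the not-onto cell, the two onto cells by the
     LANDED doors `ordKatoHalfAtTwoIsoPosDisc_of_greenbergMuZero` (p734050) / `ordKatoHalfAtTwoIso_negDisc_of_greenbergMuNeg` (p736704) — so on the
     onto habitat MU13⁻ / Poitou–Tate / the functional / the Euler system are NOT on the crux's critical path (F-48d, now by landed names on both signs);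
(E4) `g11_habitat_of_crux`: NECESSITY both signs by landed names (crux + PUB + Cassels + Abbes–Ullmo ⟹ G11⁺ ∧ G11⁻|habitat).
(E5) p737300 §5 by name: MU13⁻ + `thm12_4` contradict the `2`-divisibility hypothesis `hdiv` of the disprover's Negative lemma p691215
     (`zetaColemanMuInputsAtTwo_false_of_twoDivisible`) at every `Δ < 0` onto good-ordinary curve — the two are CONSISTENT (the Negative lemma can only
     fire where MU13⁻ fails), value-free strengthening of GEN 48 Cert48 (c).
BSD is not proved; the crux, its children, G11^±, MU13⁻ are NOT proved; everything is conditional on the displayed hypotheses; nothing is booked.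
-/

set_option autoImplicit false
set_option linter.dupNamespace false

noncomputable section

open scoped Classical MatrixGroups ModularForm NumberField
open CongruenceSubgroup WeierstrassCurve Field IsDedekindDomain NumberField
open Literature.NumberTheory.GaloisRepresentations
open Literature.NumberTheory.GaloisCohomology
open Literature.NumberTheory.EllipticCurves Literature.NumberTheory.EllipticCurves.ModularForms
  Literature.NumberTheory.EllipticCurves.GreenbergSelmer
open Literature.NumberTheory.EllipticCurves.Kato2004
  Literature.NumberTheory.EllipticCurves.Kato2004.EulerSystemValues
open Literature.NumberTheory.EllipticCurves.IwasawaDual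
open Literature.NumberTheory.EllipticCurves.Rank1Residual
open Literature.NumberTheory.EllipticCurves.Greenberg1999
open Summit.BirchSwinnertonDyer.Rank1Residual Summit.BirchSwinnertonDyer.Rank1Residual.X5
open Summit.BirchSwinnertonDyer.BirchSwinnertonDyer.Theorems.SteinbergFibreAtTwo
open Summit.BirchSwinnertonDyer.BirchSwinnertonDyer.Theorems.OrdKatoHalfAtTwoIso.Negative.ZetaColemanMuTwoDivisible
open Summit.BirchSwinnertonDyer.BirchSwinnertonDyer.Theses.ByReductionTypeAtTwo

namespace Summit.BirchSwinnertonDyer.BirchSwinnertonDyer.Cruxes.OrdKatoHalfAtTwoIso.TriageVet49s1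

/-- The REGISTERED v24 text of `stub_muFreeValue_negDisc_two` (ledger signature of skeleton 4921f2ec, verbatim; = GEN 48 `TriageVet48f.RegisteredVflatNeg`). -/
def RegisteredVflatNeg : Prop :=
  ∀ (W : WeierstrassCurve ℚ) [W.IsElliptic] [W.IsGloballyMinimal] [ContinuousSMul ℤ_[2] (W.tateModule 2)] [Module.Free ℤ_[2] (W.tateModule 2)] [Module.Finite ℤ_[2] (W.tateModule 2)] {N : ℕ} [NeZero N] (f : CuspForm (Gamma0 N) 2) (κ : ZpExtension ℚ 2) (γ : absoluteGaloisGroup ℚ) (hκ : κ.IsCyclotomic) (hγ : κ.IsTopGenerator γ), W.Δ < 0 → IsOrdinaryAt W 2 → W.HasSurjectiveModNGaloisRep 2 → IsCyclotomicVariable 2 γ → IsNewformOf W f → ∀ (v₂ : HeightOneSpectrum (𝓞 ℚ)) (_ : ((2 : ℕ) : 𝓞 ℚ) ∈ v₂.asIdeal) (γᵥ : absoluteGaloisGroup (v₂.adicCompletion ℚ)) (hsurj : Function.Surjective (κ.toContinuousMonoidHom.comp (resGalOfEmb (closureEmb (K := ℚ) (v₂.adicCompletion ℚ))))) (hγᵥ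 : κ.IsTopGenerator (resGalOfEmb (closureEmb (K := ℚ) (v₂.adicCompletion ℚ)) γᵥ)) (I : IwasawaH1Data W 2 κ γ) (J : LocalIwasawaH1Data κ v₂ ((tateRep W 2).toLocal v₂) γᵥ) (J' : LocalIwasawaH1Data κ v₂ (tateLocalOrdinaryRep W 2 v₂) γᵥ) (col : J.H →ₗ[IwasawaAlgebra 2] IwasawaAlgebra 2), (∀ x : J.H, col x = 0 ↔ x ∈ LinearMap.range (J'.ordinaryInclusion J)) → (∃ x : J.H, col x ∉ IwasawaAlgebra.augIdealP 2) → ∃ g : I.H, IsEulerSystemClassTwo W hκ I g ∧ col (I.loc J hsurj hγ hγᵥ g) ∉ IwasawaAlgebra.augIdealP 2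

/-- **(E1) KERNEL-EXACT: the registered V♭⁻ text ⟺ (G11⁻ ∧ MU13⁻)** modulo {p729889, p727215, `thm12_4`, PUB} — `exact` w3 g7's landed iff (p736704).
Neither side is proved; nothing asserted. [cite: Kato2004Asterisque, Thm. 12.4 (2) (p. 221), §17.13 (pp. 279–280)] [cite: GreenbergLNM1716, Conj. 1.11 (p. 64)] -/
theorem registered_iff_split (hPT : exists_lambdaAdicLocalTatePairing_poitouTate_exact)
    (hOK : exists_ordinaryKernelFunctional) (h12 : thm12_4) (hPub : OrdPublishedInputsAtTwo) :
    RegisteredVflatNeg ↔ (GreenbergMuZeroTwoOrdNegDisc ∧ ZetaQuotientMuZeroTwoOrdNegDisc) :=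
  muFreeValue_negDisc_iff_greenbergMuNeg_and_zetaQuotientMu hPT hOK h12 hPub

/-- **(E2) the (⇐) direction consumed by a v25 option-(b) drop-in** needs only p729889 + PUB: {G11⁻, MU13⁻} ⟹ the registered text VERBATIM.
CONDITIONAL; nothing asserted. [cite: Kato2004Asterisque, §17.13 (pp. 279–280)] [cite: GreenbergLNM1716, Conj. 1.11 (p. 64)] -/
theorem registered_of_split (hPT : exists_lambdaAdicLocalTatePairing_poitouTate_exact) (hPub : OrdPublishedInputsAtTwo)
    (hG : GreenbergMuZeroTwoOrdNegDisc) (hZ : ZetaQuotientMuZeroTwoOrdNegDisc) : RegisteredVflatNeg :=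
  muFreeValue_negDisc_of_greenbergMuNeg_of_zetaQuotientMu hPT hPub hG hZ

/-- The crux restricted to the NOT-onto cell (child 23921's road; displayed, = GEN 48 `TriageVet48f.CruxNotOntoText`). -/
def CruxNotOntoText : Prop :=
  ∀ (W : WeierstrassCurve ℚ) [W.IsElliptic] [W.IsGloballyMinimal], ¬ W.HasCM → W.analyticRank = 0 → GoodOrd W 2 →
    ¬ W.HasSurjectiveModNGaloisRep 2 →
    ∃ (W' : WeierstrassCurve ℚ) (_ : W'.IsElliptic) (_ : W'.IsGloballyMinimal),
      IsIsogenous W W' ∧ O1.MainConjectureLowerDivisibilityAtTwoOrd W'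

/-- The `0 < Δ` conjunct is the crux RESTRICTED (two extra binders): trivial monotonicity, displayed for (E4). [folklore] -/
theorem posDisc_of_crux (hcrux : OrdKatoHalfAtTwoIso) : OrdKatoHalfAtTwoIsoPosDisc :=
  fun W _ _ hcm hr hgo _ _ => hcrux W hcm hr hgo

/-- **(E3) the ROUTE DECL BY NAME from {G11⁺, G11⁻} + PUB + Abbes–Ullmo + the not-onto cell, BOTH onto cells by LANDED doors** (p734050 §2 /
p736704 §4): on the onto habitat nothing but Greenberg's Conjecture 1.11 at `2` (both signs) and print is consumed — no MU13⁻, no Poitou–Tate, no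
ordinary-kernel functional, no Euler-system class. CONDITIONAL on the displayed OPEN statements; the crux is NOT proved.
[cite: GreenbergLNM1716, Conj. 1.11 (p. 64)] [cite: Kato2004Asterisque, Thm. 17.4 (1)(2) (p. 273)] [cite: AbbesUllmo1996, Thm. A] -/
theorem crux_of_g11_landed (hP : GreenbergMuZeroTwoOrdPosDisc) (hN : GreenbergMuZeroTwoOrdNegDisc)
    (hPub : OrdPublishedInputsAtTwo) (hAU : abbesUllmo_not_dvd_maninConstant_of_not_dvd_level)
    (hno : CruxNotOntoText) : OrdKatoHalfAtTwoIso := by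
  obtain ⟨-, -, h17, -⟩ := hPub
  intro W _ _ hcm hr hgo
  by_cases h2 : W.HasSurjectiveModNGaloisRep 2
  · rcases lt_trichotomy W.Δ 0 with hΔ | hΔ | hΔ
    · exact ordKatoHalfAtTwoIso_negDisc_of_greenbergMuNeg hN hAU h17 W hcm hr hgo h2 hΔ
    · exact absurd hΔ W.isUnit_Δ.ne_zero
    · exact ordKatoHalfAtTwoIsoPosDisc_of_greenbergMuZero hP hAU h17 W hcm hr hgo h2 hΔ
  · exact hno W hcm hr hgo h2

/-- **(E4) NECESSITY, both signs, by LANDED names**: the crux + PUB + Cassels + Abbes–Ullmo ⟹ G11⁺ (whose def carries the habitat binders) ∧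
G11⁻ restricted to the habitat. With (E3): on the onto habitat the crux ⟺ Greenberg's Conjecture 1.11 at `2` modulo {PUB, Cassels, AU} —
the `Δ < 0` memo MU13⁻ is EXCESS over the crux (needed only for the structural child F1μι⁻ / 24097's packaging). CONDITIONAL; nothing asserted.
[cite: GreenbergLNM1716, Conj. 1.11 (p. 64)] [cite: Kato2004Asterisque, Thm. 17.4 (1)(2) (p. 273)] [cite: MilneADT2006, Thm. I.7.3 (Cassels)] [cite: AbbesUllmo1996, Thm. A] -/
theorem g11_habitat_of_crux (hcrux : OrdKatoHalfAtTwoIso) (hPub : OrdPublishedInputsAtTwo)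
    (hCassels : bsdRHS_eq_of_isIsogenous) (hAU : abbesUllmo_not_dvd_maninConstant_of_not_dvd_level) :
    GreenbergMuZeroTwoOrdPosDisc ∧
    (∀ (W : WeierstrassCurve ℚ) [W.IsElliptic] [W.IsGloballyMinimal],
      ¬ W.HasCM → W.analyticRank = 0 → GoodOrd W 2 → W.HasSurjectiveModNGaloisRep 2 → W.Δ < 0 →
      ∀ (κ : ZpExtension ℚ 2) (γ : absoluteGaloisGroup ℚ), κ.IsCyclotomic → κ.IsTopGenerator γ →
        IsCyclotomicVariable 2 γ → ∀ D : W.SelmerDualData κ γ, D.mu = 0) :=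
  ⟨greenbergMuZeroTwoOrdPosDisc_of_posDisc (posDisc_of_crux hcrux) hPub hCassels hAU,
   greenbergMuZeroTwoOrdNegDisc_habitat_of_ordKatoHalfAtTwoIso hcrux hPub hCassels hAU⟩

/-- **(E5) p737300 §5 BY NAME against the disprover's Negative lemma p691215**: under MU13⁻ + `thm12_4`, the `2`-divisibility hypothesis `hdiv` of
`zetaColemanMuInputsAtTwo_false_of_twoDivisible` is CONTRADICTORY at every `Δ < 0` good-ordinary onto curve — so that Negative lemma cannot fire on the
`Δ < 0` cell under MU13⁻ (consistent with child 24097's sign split; a value-free strengthening of GEN 48 Cert48 (c)). CONDITIONAL; nothing asserted.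
[cite: Kato2004Asterisque, Thm. 12.4 (2) (p. 221), §17.13 (p. 280)] -/
theorem negativeLemma_hyp_false_of_zetaQuotientMu (h12 : thm12_4) (hZ : ZetaQuotientMuZeroTwoOrdNegDisc)
    (W : WeierstrassCurve ℚ) [W.IsElliptic] [W.IsGloballyMinimal]
    [ContinuousSMul ℤ_[2] (W.tateModule 2)] [Module.Free ℤ_[2] (W.tateModule 2)] [Module.Finite ℤ_[2] (W.tateModule 2)]
    (κ : ZpExtension ℚ 2) (γ : absoluteGaloisGroup ℚ) (hκ : κ.IsCyclotomic) (hγ : κ.IsTopGenerator γ)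
    (hΔ : W.Δ < 0) (hord : IsOrdinaryAt W 2) (h2 : W.HasSurjectiveModNGaloisRep 2) (hγ' : IsCyclotomicVariable 2 γ)
    (hdiv : ∀ (I : IwasawaH1Data W 2 κ γ) (s : I.H), IsEulerSystemClassTwo W hκ I s →
      s ∈ IwasawaAlgebra.augIdealP 2 • (⊤ : Submodule (IwasawaAlgebra 2) I.H)) : False :=
  not_forall_isEulerSystemClassTwo_mem_two_smul_top_of_zetaQuotientMu h12 hZ W κ γ hκ hγ hΔ hord h2 hγ' hdiv

/-- (E5′) and where `hdiv` DOES hold (MU13⁻ failing there), the Negative lemma kills the SIGN-FREE F1 inputs `ZetaColemanMuInputsAtTwo` — by name, unchanged. -/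
example (W : WeierstrassCurve ℚ) [W.IsElliptic] [W.IsGloballyMinimal]
    [ContinuousSMul ℤ_[2] (W.tateModule 2)] [Module.Free ℤ_[2] (W.tateModule 2)]
    [Module.Finite ℤ_[2] (W.tateModule 2)] {N : ℕ} [NeZero N] (f : CuspForm (Gamma0 N) 2)
    (κ : ZpExtension ℚ 2) (γ : absoluteGaloisGroup ℚ) (hκ : κ.IsCyclotomic)
    (hord : IsOrdinaryAt W 2) (h2 : W.HasSurjectiveModNGaloisRep 2) (hγ : κ.IsTopGenerator γ)
    (hcv : IsCyclotomicVariable 2 γ) (hf : IsNewformOf W f)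
    (D : W.SelmerDualData κ γ) (Y : W.FineSelmerDualData κ γ)
    (hdiv : ∀ (I : IwasawaH1Data W 2 κ γ) (s : I.H), IsEulerSystemClassTwo W hκ I s →
      s ∈ IwasawaAlgebra.augIdealP 2 • (⊤ : Submodule (IwasawaAlgebra 2) I.H)) :
    ¬ ZetaColemanMuInputsAtTwo :=
  zetaColemanMuInputsAtTwo_false_of_twoDivisible W f κ γ hκ hord h2 hγ hcv hf D Y hdiv

end Summit.BirchSwinnertonDyer.BirchSwinnertonDyer.Cruxes.OrdKatoHalfAtTwoIso.TriageVet49s1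

end
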